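import Mathlib
import Literature.Analysis.FluidPDE.VectorCalculus
import Literature.Analysis.FluidPDE.SelfSimilar
import Literature.Analysis.FluidPDE.MildSolution
import Literature.Analysis.FluidPDE.NSBoundedMildSmoothing
import Summits.NavierStokesRegularity.NavierStokesRegularity.Theses.UnthreadedRigidityDoor
import Summits.NavierStokesRegularity.NavierStokesRegularity.Theorems.ThreadingFluxCentreJetDefs
import Summits.NavierStokesRegularity.NavierStokesRegularity.Theorems.ThreadingFluxSilentShellsTwoAxesTools
import Summits.NavierStokesRegularity.NavierStokesRegularity.Theorems.ThreadingFluxPlatonicDefs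
import Summits.NavierStokesRegularity.NavierStokesRegularity.Theorems.ThreadingFluxPlatonicSymmetryAlgebra
import Summits.NavierStokesRegularity.NavierStokesRegularity.Theorems.ThreadingFluxPlatonicWindowGlue
import Summits.NavierStokesRegularity.NavierStokesRegularity.Theorems.ThreadingFluxPlatonicAncientOseen
import Summits.NavierStokesRegularity.NavierStokesRegularity.Theorems.ThreadingFluxPlatonicWindowGlueGeneral
import HarnessLib

/-!
# Crux `PoloidalLiouville` (stmt-NavierStokesRegularity-1222, W1) / `UnthreadedRigidity` (stmt-…-27585, W2), crux idea «platonic-germ-sieve»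
# (ns-idea-15 g11, V27): the platonic wiring for EVERY symmetry class of linear isometries preserving no axis — final, class-free form

Support file (Theorems-side; seat ns-wall-eng-8 g8, cell `ns-wall-extremal`; `--supports stmt-NavierStokesRegularity-1222 --as helper`; 0 kit).
eng-8 g7's `Platonic.symmetricPoloidalLiouville_of_unthreadedRigidity_of_rotations` (`ThreadingFluxPlatonicWindowGlueGeneral.lean`, p727166)
asks of the symmetry class `G` three things: rotation data (each `g ∈ G` is a linear isometry PRESERVING THE CROSS PRODUCT), `FixesNoVector G`
and `PreservesNoAxis G`.  Here the first is weakened to «each `g ∈ G` is a linear isometry» and the second is dropped: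

* ★ `Platonic.exists_sign_cross_map_of_linearIsometryEquiv` — every linear isometry `L` of `ℝ³` satisfies `L (u × v) = ε • (L u × L v)` with
  `ε ∈ {1, −1}` (`ε = det L`).  Orthonormal-frame proof, no matrices: with `a, b, c` the images of the standard basis,
  `⟪L u × L v, L w⟫ = ⟪a × b, c⟫ · ⟪u × v, w⟫` (multiplicativity of the `3 × 3` determinant, a polynomial identity) and
  `⟪a × b, c⟫² = det Gram(a, b, c) = 1`.
* `Platonic.fderiv_cross_of_equivariant_sign` — the transport lemma `fderiv_cross_of_equivariant` (`ThreadingFluxPlatonicSymmetryAlgebra.lean`) for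
  symmetries preserving the cross product UP TO A SIGN `ε`, `ε² = 1`: the identity `DW(x)[c × x] = c × W(x)` passes from `c` to `L c` because the sign
  enters twice.  So the subspace of good axial vectors of a slice is stable under IMPROPER symmetries as well.
* `Platonic.fixesNoVector_of_preservesNoAxis : PreservesNoAxis G → FixesNoVector G` — a `G`-fixed `b ≠ 0` spans a `G`-preserved axis; the
  `FixesNoVector` binder of p727166 is idle.
* `Platonic.symmetricPoloidalLiouville_of_symmetricWindowRigidity` — W1|_G from W2|_G for every set `G` of linear isometries fixing no vector (the
  duality-class-to-window conversion of p727166, factored out: honest Oseen-mildness from `Platonic.oseenMild_of_equivariant`, p725805).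
* ★ `Platonic.symmetricWindowRigidity_of_unthreadedRigidity_of_isometries (hGiso : ∀ g ∈ G, ∃ L : E3 ≃ₗᵢ[ℝ] E3, ∀ x, L x = g x)
  (hGaxis : PreservesNoAxis G) : UnthreadedRigidity → SymmetricWindowRigidity G` — the W2 wiring for every such class.
* ★★ `Platonic.symmetricPoloidalLiouville_of_unthreadedRigidity_of_isometries (hGiso) (hGaxis) : UnthreadedRigidity → SymmetricPoloidalLiouville G`
  — THE FINAL FORM: W1 restricted to ANY symmetry class `G ⊆ O(3)` irreducible on `ℝ³` (the rotation groups T, O, I, the full groups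
  `T_d, T_h, O_h, I_h`, all their `O(3)`-conjugates, and any generating SET of such a group) sits below the W2 door ⟨27585⟩ BY NAME, with the
  single hypothesis `PreservesNoAxis G`.
* negation homes `Platonic.not_unthreadedRigidity_of_windowSolution_of_isometries` / `…_of_symmetricCounterexample_of_isometries`;
* `Platonic.symmetricSteadyLiouville_of_symmetricWindowRigidity` and ★ `Platonic.symmetricSteadyLiouville_of_unthreadedRigidity_of_isometries` —
  the STEADY stratum `SymmetricSteadyLiouville G` for every such class from ⟨27585⟩ alone (p722700's octahedral argument, factored through the
  window statement), independent of the sieve's conjecture `OctahedralCentreRigidity`;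
* consistency check (not re-stated, it is p725805 (iv) verbatim): the octahedral theorem `symmetricPoloidalLiouville_octahedral_of_unthreadedRigidity`
  is the instance `symmetricPoloidalLiouville_of_unthreadedRigidity_of_isometries (fun _ hg => exists_linearIsometryEquiv_of_mem_octahedral hg)
  octahedral_preservesNoAxis` — no cross-product certificate for the 24 rotations is needed.

HONEST LABEL: conditional glue strictly below W1/W2 (hypothesis ⟨27585⟩); `OctahedralCentreRigidity`, ⟨1222⟩, ⟨27585⟩ and NS regularity are OPEN
and NOT touched; information-grade (movement 0).

## References
* G. Koch, N. Nadirashvili, G. Seregin, V. Šverák, Acta Math. 203 (2009) 83–105, arXiv:0709.3599 (bounded ancient mild solutions).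
* L. Brandolese, Math. Ann. 329 (2004) 685–706, arXiv:math/0304436 (polyhedral symmetry classes of NS flows).
-/

-- the summit and its single sub-problem share the name (CONVENTIONS §1)
set_option linter.dupNamespace false

noncomputable section

open Set Function Filter Metric MeasureTheory Module
open scoped RealInnerProductSpace Topology
open Literature.Analysis.FluidPDE
open Summit.NavierStokesRegularity.NavierStokesRegularity.Theses
open Summit.NavierStokesRegularity.NavierStokesRegularity.Theorems.PoloidalLiouville.CentreJet (E3)
open Summit.NavierStokesRegularity.NavierStokesRegularity.Theorems.PoloidalLiouville.SilentShells (TwoAxes.exists_cross_of_skew)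

namespace Summit.NavierStokesRegularity.NavierStokesRegularity.Theorems.PoloidalLiouville.Platonic

/-! ## Coordinates -/

/-- The triple product `⟪p × q, r⟫` in coordinates. -/
theorem inner_cross_eq_coord (p q r : E3) :
    ⟪cross p q, r⟫ = (p 1 * q 2 - p 2 * q 1) * r 0 + (p 2 * q 0 - p 0 * q 2) * r 1 + (p 0 * q 1 - p 1 * q 0) * r 2 := by
  simp [cross, crossProduct, PiLp.inner_apply, Fin.sum_univ_three]; ring

/-- Coordinates of a combination of three vectors. -/
theorem lincomb_apply (u a b c : E3) (i : Fin 3) : (u 0 • a + u 1 • b + u 2 • c) i = u 0 * a i + u 1 * b i + u 2 * c i := by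
  simp

/-- Every vector of `ℝ³` is the combination of the standard basis vectors with its coordinates. -/
theorem eq_lincomb_single (u : E3) :
    u = u 0 • EuclideanSpace.single 0 (1 : ℝ) + u 1 • EuclideanSpace.single 1 (1 : ℝ) + u 2 • EuclideanSpace.single 2 (1 : ℝ) := by
  ext i; fin_cases i <;> simp

/-! ## ★ A linear isometry of `ℝ³` preserves the cross product up to a sign -/

/-- ★ **A linear isometry of `ℝ³` preserves the cross product up to a sign** (`det L = ±1`): `L (u × v) = ε • (L u × L v)` with
`ε ∈ {1, −1}`.  Orthonormal-frame proof: with `a, b, c` the images of the standard basis vectors, `⟪L u × L v, L w⟫ = ⟪a × b, c⟫ · ⟪u × v, w⟫`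
(multiplicativity of the `3 × 3` determinant, a polynomial identity) and `⟪a × b, c⟫² = det Gram(a, b, c) = 1` (orthonormality); then pair
`L (u × v) − ε • (L u × L v)` with `L w` for arbitrary `w` (`L` is onto). -/
theorem exists_sign_cross_map_of_linearIsometryEquiv (L : E3 ≃ₗᵢ[ℝ] E3) :
    ∃ ε : ℝ, (ε = 1 ∨ ε = -1) ∧ ∀ u v : E3, L (cross u v) = ε • cross (L u) (L v) := by
  set a : E3 := L (EuclideanSpace.single 0 (1 : ℝ)) with ha
  set b : E3 := L (EuclideanSpace.single 1 (1 : ℝ)) with hb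
  set c : E3 := L (EuclideanSpace.single 2 (1 : ℝ)) with hc
  have hL : ∀ u : E3, L u = u 0 • a + u 1 • b + u 2 • c := fun u => by
    conv_lhs => rw [eq_lincomb_single u]
    simp only [map_add, map_smul, ha, hb, hc]
  -- orthonormality of the frame
  have haa : ⟪a, a⟫ = 1 := by rw [ha, L.inner_map_map]; simp
  have hbb : ⟪b, b⟫ = 1 := by rw [hb, L.inner_map_map]; simp
  have hcc : ⟪c, c⟫ = 1 := by rw [hc, L.inner_map_map]; simp
  have hab : ⟪a, b⟫ = 0 := by rw [ha, hb, L.inner_map_map]; simp [EuclideanSpace.inner_single_left]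
  have hac : ⟪a, c⟫ = 0 := by rw [ha, hc, L.inner_map_map]; simp [EuclideanSpace.inner_single_left]
  have hbc : ⟪b, c⟫ = 0 := by rw [hb, hc, L.inner_map_map]; simp [EuclideanSpace.inner_single_left]
  set ε : ℝ := ⟪cross a b, c⟫ with hε
  -- `ε² = det Gram(a, b, c) = 1`
  have hgram : ε * ε = ⟪a, a⟫ * ⟪b, b⟫ * ⟪c, c⟫ + 2 * ⟪a, b⟫ * ⟪b, c⟫ * ⟪a, c⟫
      - ⟪a, a⟫ * ⟪b, c⟫ ^ 2 - ⟪b, b⟫ * ⟪a, c⟫ ^ 2 - ⟪c, c⟫ * ⟪a, b⟫ ^ 2 := by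
    have hin : ∀ p r : E3, ⟪p, r⟫ = p 0 * r 0 + p 1 * r 1 + p 2 * r 2 := fun p r => by
      simp [PiLp.inner_apply, Fin.sum_univ_three, mul_comm]
    rw [hε, inner_cross_eq_coord a b c]
    simp only [hin]
    ring
  have hε2 : ε * ε = 1 := by rw [hgram, haa, hbb, hcc, hab, hac, hbc]; ring
  -- multiplicativity of the determinant
  have hdet : ∀ u v w : E3, ⟪cross (L u) (L v), L w⟫ = ε * ⟪cross u v, w⟫ := by
    intro u v w
    rw [hL u, hL v, hL w, hε]
    simp only [inner_cross_eq_coord, lincomb_apply]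
    ring
  refine ⟨ε, mul_self_eq_one_iff.1 hε2, fun u v => ?_⟩
  apply ext_inner_right ℝ
  intro z
  obtain ⟨w, rfl⟩ := L.surjective z
  rw [real_inner_smul_left, hdet, L.inner_map_map, ← mul_assoc, hε2, one_mul]

/-! ## Transport of the infinitesimal axis along a symmetry preserving `×` up to a sign -/

/-- **Transport with a sign.**  `W` differentiable, `W ∘ L = L ∘ W` for a surjective continuous linear `L` with `L (u × v) = ε • (L u × L v)`,
`ε² = 1`; then `DW(x)[c × x] = c × W(x)` for all `x` implies the same for the axial vector `L c` — the sign enters twice and cancels.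
(For `ε = 1` this is `fderiv_cross_of_equivariant`.) -/
theorem fderiv_cross_of_equivariant_sign {W : E3 → E3} (hW : Differentiable ℝ W) (L : E3 →L[ℝ] E3)
    (hsurj : Function.Surjective L) {ε : ℝ} (hε : ε * ε = 1) (hcross : ∀ u v : E3, L (cross u v) = ε • cross (L u) (L v))
    (hequi : ∀ x, W (L x) = L (W x)) {c : E3} (hc : ∀ x, fderiv ℝ W x (cross c x) = cross c (W x)) (y : E3) :
    fderiv ℝ W y (cross (L c) y) = cross (L c) (W y) := by
  obtain ⟨x, rfl⟩ := hsurj y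
  -- chain rule on `W ∘ L = L ∘ W`
  have hcomp : HasFDerivAt (fun z => W (L z)) ((fderiv ℝ W (L x)).comp L) x :=
    (hW (L x)).hasFDerivAt.comp x L.hasFDerivAt
  have hcomp' : HasFDerivAt (fun z => L (W z)) (L.comp (fderiv ℝ W x)) x :=
    L.hasFDerivAt.comp x (hW x).hasFDerivAt
  have hfun : (fun z => W (L z)) = fun z => L (W z) := funext hequi
  rw [hfun] at hcomp
  have hD : (fderiv ℝ W (L x)).comp L = L.comp (fderiv ℝ W x) := hcomp.unique hcomp'
  have hDv : ∀ v, fderiv ℝ W (L x) (L v) = L (fderiv ℝ W x v) := fun v => by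
    simpa using congrArg (fun T : E3 →L[ℝ] E3 => T v) hD
  have hcross' : ∀ u v : E3, cross (L u) (L v) = ε • L (cross u v) := fun u v => by
    rw [hcross, smul_smul, hε, one_smul]
  rw [hcross', map_smul, hDv, hc x, hcross, hequi, smul_smul, hε, one_smul]

/-! ## `PreservesNoAxis` implies `FixesNoVector` -/

/-- A set of maps preserving no axis fixes no vector: a `G`-fixed `b ≠ 0` spans a `G`-preserved axis. -/
theorem fixesNoVector_of_preservesNoAxis {G : Set (E3 → E3)} (h : PreservesNoAxis G) : FixesNoVector G := by
  intro b hb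
  by_contra hb0
  obtain ⟨g, hg, hga⟩ := h b hb0
  exact hga 1 (by rw [one_smul]; exact hb g hg)

/-! ## W1|_G from W2|_G for every class of linear isometries fixing no vector -/

/-- **Duality class → window.**  For a set `G` of (coercions of) linear isometries fixing no vector, `SymmetricWindowRigidity G` implies
`SymmetricPoloidalLiouville G`: a bounded ancient mild solution of the KNSS duality class, smooth on `(−∞,0) × ℝ³` and `G`-equivariant, is an
HONEST Oseen-mild window solution on `S = (−∞, 0)` (`oseenMild_of_equivariant` kills the parasitic constant), continuous, classically
divergence free, uniformly bounded. -/
theorem symmetricPoloidalLiouville_of_symmetricWindowRigidity {G : Set (E3 → E3)}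
    (hGiso : ∀ g ∈ G, ∃ L : E3 ≃ₗᵢ[ℝ] E3, ∀ x, L x = g x) (hGfix : FixesNoVector G) (hW : SymmetricWindowRigidity G) :
    SymmetricPoloidalLiouville G := by
  intro v hv hmeas hsm hun hequi t ht x
  have hcont : ContinuousOn (Function.uncurry v) (Iio (0 : ℝ) ×ˢ (univ : Set E3)) := hsm.continuousOn
  have hmild := oseenMild_of_equivariant hGfix hGiso hv hmeas hcont hequi
  -- each negative slice is `C¹`, hence classically divergence free
  have hslice : ∀ τ < (0 : ℝ), ContDiff ℝ 1 (v τ) := by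
    intro τ hτ
    have hι : ContDiff ℝ (⊤ : ℕ∞) (fun y : E3 => ((τ, y) : ℝ × E3)) := contDiff_const.prodMk contDiff_id
    have hmem : ∀ y : E3, ((τ, y) : ℝ × E3) ∈ Iio (0 : ℝ) ×ˢ (univ : Set E3) := fun y => ⟨hτ, mem_univ y⟩
    exact (hsm.comp_contDiff hι hmem).of_le (by norm_cast)
  have hdiv : ∀ τ ∈ Iio (0 : ℝ), VectorCalculus.IsDivFree (v τ) :=
    fun τ hτ => (hv.1.1 τ hτ).isDivFree_of_contDiff (hslice τ hτ)
  have hbdd : ∀ τ ∈ Iio (0 : ℝ), ∃ B : ℝ, ∀ t ∈ Iio (0 : ℝ), t ≤ τ → ∀ y, ‖v t y‖ ≤ B := by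
    intro τ _
    obtain ⟨C, hC⟩ := hv.2
    exact ⟨C, fun t ht _ y => hC t ht y⟩
  have hun' : ∀ t ∈ Iio (0 : ℝ), ∀ y, inner ℝ (curl (v t) y) y = 0 :=
    fun t ht y => by rw [real_inner_comm]; exact hun t ht y
  have hequi' : ∀ t ∈ Iio (0 : ℝ), IsEquivariant G (v t) := fun t ht => hequi t ht
  exact hW (Iio 0) isOpen_Iio isPreconnected_Iio v hcont hdiv hmild hbdd hun' hequi' t ht x

/-! ## ★ The W2 wiring for every class of linear isometries preserving no axis -/

/-- ★ **W2 restricted to a class of linear isometries preserving no axis follows from ⟨27585⟩.**  Let `G` be a set of self-maps of `ℝ³`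
each of which is (the coercion of) a linear isometry — proper or improper — and assume `G` preserves no axis.  If `UnthreadedRigidity`
holds, then every continuous, divergence-free, bounded, Oseen-mild window solution on an open preconnected time set, unthreaded about `0`
and `G`-equivariant at every time, VANISHES identically.  (⟨27585⟩ gives one axial vector `w ≠ 0` with `DW(x)[w × x] = w × W(x)`; the good
axial vectors form a subspace, stable under `G` by `exists_sign_cross_map_of_linearIsometryEquiv` + `fderiv_cross_of_equivariant_sign`, hence
all of `ℝ³` by `submodule_eq_top_of_stable`; the radial lemma `eq_zero_of_fderiv_cross_all` concludes.) -/
theorem symmetricWindowRigidity_of_unthreadedRigidity_of_isometries {G : Set (E3 → E3)}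
    (hGiso : ∀ g ∈ G, ∃ L : E3 ≃ₗᵢ[ℝ] E3, ∀ x, L x = g x) (hGaxis : PreservesNoAxis G)
    (h27585 : UnthreadedRigidityDoor.UnthreadedRigidity) : SymmetricWindowRigidity G := by
  intro S hS hpre u hcont hdiv hmild hbdd hun hequi t ht x
  -- ⟨27585⟩ at the centre `0`: one infinitesimal axis
  obtain ⟨A, hAskew, hAne, hAeq⟩ := h27585 S hS hpre u 0 hcont hdiv hmild hbdd
    (fun t ht x => by rw [sub_zero]; exact hun t ht x)
  have hWan : AnalyticOnNhd ℝ (u t) univ := analyticOnNhd_slice hS hpre hcont hdiv hmild hbdd ht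
  have hW1 : ContDiff ℝ 1 (u t) := contDiffOn_univ.1 hWan.contDiffOn_of_completeSpace
  have hWd : Differentiable ℝ (u t) := hW1.differentiable one_ne_zero
  have hskew : ∀ x y : E3, ⟪A x, y⟫ = -⟪x, A y⟫ := by
    intro x y
    have h := hAskew (x + y)
    rw [map_add, inner_add_left, inner_add_right, inner_add_right, hAskew x, hAskew y, zero_add, add_zero] at h
    have hc : ⟪x, A y⟫ = ⟪A y, x⟫ := real_inner_comm (A y) x
    linarith
  obtain ⟨w, hw⟩ := TwoAxes.exists_cross_of_skew A hskew
  have hw0 : w ≠ 0 := by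
    intro h0
    apply hAne
    ext y i
    simp [hw y, h0, cross, crossProduct]
  have hPw : ∀ y, fderiv ℝ (u t) y (cross w y) = cross w (u t y) := fun y => by
    have h := hAeq t ht y
    rw [sub_zero, hw, hw, sub_eq_zero] at h
    exact h
  -- the good axial vectors form a `G`-stable non-zero subspace
  let V : Submodule ℝ E3 :=
    { carrier := {c | ∀ y, fderiv ℝ (u t) y (cross c y) = cross c (u t y)}
      add_mem' := fun {c₁ c₂} h₁ h₂ y => by
        have h := fderiv_cross_lincomb h₁ h₂ 1 1 y
        simpa only [one_smul] using h
      zero_mem' := fun y => by simp [cross, crossProduct]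
      smul_mem' := fun r c h y => by
        have h' := fderiv_cross_lincomb h h r 0 y
        simpa only [zero_smul, add_zero] using h' }
  have hmemV : ∀ c : E3, c ∈ V ↔ ∀ y, fderiv ℝ (u t) y (cross c y) = cross c (u t y) := fun c => Iff.rfl
  have hV : V ≠ ⊥ := by
    intro h
    have hwV : w ∈ V := (hmemV w).2 hPw
    rw [h, Submodule.mem_bot] at hwV
    exact hw0 hwV
  have hstab : ∀ g ∈ G, ∀ c ∈ V, g c ∈ V := by
    intro g hg c hc
    obtain ⟨L, hL⟩ := hGiso g hg
    obtain ⟨ε, hε1, hLcross⟩ := exists_sign_cross_map_of_linearIsometryEquiv L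
    have hε : ε * ε = 1 := by rcases hε1 with h | h <;> simp [h]
    rw [hmemV] at hc ⊢
    have hequiL : ∀ y, u t (L y) = L (u t y) := fun y => by
      rw [hL y, hL (u t y)]; exact hequi t ht g hg y
    have h := fderiv_cross_of_equivariant_sign hWd (L : E3 →L[ℝ] E3) L.surjective hε
      (fun a b => hLcross a b) (fun y => hequiL y) hc
    intro y
    have hy := h y
    simp only [LinearIsometryEquiv.coe_coe''] at hy
    rw [← hL c]
    exact hy
  have hVtop : V = ⊤ := submodule_eq_top_of_stable hGiso hGaxis V hV hstab
  have hall : ∀ c y : E3, fderiv ℝ (u t) y (cross c y) = cross c (u t y) := fun c =>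
    (hmemV c).1 (hVtop ▸ Submodule.mem_top)
  have hzero : u t = 0 := eq_zero_of_fderiv_cross_all hW1 (hdiv t ht) hall
  simp [hzero]

/-- **Negation home on W2 for a class of linear isometries.**  One non-zero `G`-equivariant, unthreaded, bounded, divergence-free Oseen-mild
window solution (`G` a set of linear isometries preserving no axis) refutes ⟨27585⟩. -/
theorem not_unthreadedRigidity_of_windowSolution_of_isometries {G : Set (E3 → E3)}
    (hGiso : ∀ g ∈ G, ∃ L : E3 ≃ₗᵢ[ℝ] E3, ∀ x, L x = g x) (hGaxis : PreservesNoAxis G)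
    {S : Set ℝ} (hS : IsOpen S) (hpre : IsPreconnected S)
    {u : ℝ → E3 → E3} (hcont : ContinuousOn (Function.uncurry u) (S ×ˢ univ))
    (hdiv : ∀ t ∈ S, VectorCalculus.IsDivFree (u t))
    (hmild : ∀ s ∈ S, ∀ t ∈ S, s < t → ∀ x, u t x =
        Literature.Analysis.UnboundedOperators.heatExtension (u s) (t - s) x - oseenDuhamel 1 s u u t x)
    (hbdd : ∀ τ ∈ S, ∃ B : ℝ, ∀ t ∈ S, t ≤ τ → ∀ x, ‖u t x‖ ≤ B)
    (hun : ∀ t ∈ S, ∀ x, inner ℝ (curl (u t) x) x = 0) (hequi : ∀ t ∈ S, IsEquivariant G (u t))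
    {t : ℝ} (ht : t ∈ S) {x : E3} (hx : u t x ≠ 0) : ¬ UnthreadedRigidityDoor.UnthreadedRigidity := fun h =>
  hx (symmetricWindowRigidity_of_unthreadedRigidity_of_isometries hGiso hGaxis h S hS hpre u hcont hdiv hmild hbdd hun hequi t ht x)

/-! ## ★★ W1 restricted to every class of linear isometries preserving no axis, from ⟨27585⟩, BY NAME -/

/-- ★★ **`SymmetricPoloidalLiouville G` ⇐ ⟨27585⟩ for every set `G` of linear isometries of `ℝ³` preserving no axis — the final form of the
platonic wiring.**  If `UnthreadedRigidity` holds, every bounded ancient mild solution (KNSS duality class, `ν = 1`) with a.e.-strongly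
measurable slices, smooth on `(−∞,0) × ℝ³`, unthreaded about `0` and `G`-equivariant at every negative time VANISHES on `t < 0`.  Covers every
symmetry class irreducible on `ℝ³`: the rotation groups of the Platonic solids, the full polyhedral groups (with reflections / the inversion),
their conjugates, and any generating set of such a group.  `FixesNoVector G` is automatic (`fixesNoVector_of_preservesNoAxis`).  Conditional on
⟨27585⟩. -/
theorem symmetricPoloidalLiouville_of_unthreadedRigidity_of_isometries {G : Set (E3 → E3)}
    (hGiso : ∀ g ∈ G, ∃ L : E3 ≃ₗᵢ[ℝ] E3, ∀ x, L x = g x) (hGaxis : PreservesNoAxis G)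
    (h27585 : UnthreadedRigidityDoor.UnthreadedRigidity) : SymmetricPoloidalLiouville G :=
  symmetricPoloidalLiouville_of_symmetricWindowRigidity hGiso (fixesNoVector_of_preservesNoAxis hGaxis)
    (symmetricWindowRigidity_of_unthreadedRigidity_of_isometries hGiso hGaxis h27585)

/-- **Negation home on W1 for a class of linear isometries.**  A member of `SymmetricCounterexample G` (`G` a set of linear isometries
preserving no axis) refutes ⟨27585⟩ `UnthreadedRigidity`. -/
theorem not_unthreadedRigidity_of_symmetricCounterexample_of_isometries {G : Set (E3 → E3)}
    (hGiso : ∀ g ∈ G, ∃ L : E3 ≃ₗᵢ[ℝ] E3, ∀ x, L x = g x) (hGaxis : PreservesNoAxis G) (hc : SymmetricCounterexample G) :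
    ¬ UnthreadedRigidityDoor.UnthreadedRigidity := by
  intro h
  obtain ⟨v, hv, hmeas, hsm, hun, hequi, t, ht, x, hx⟩ := hc
  exact hx (symmetricPoloidalLiouville_of_unthreadedRigidity_of_isometries hGiso hGaxis h v hv hmeas hsm hun hequi t ht x)


/-! ## The steady stratum for every class preserving no axis -/

/-- **Window ⇒ steady, any class.**  `SymmetricWindowRigidity G` implies the steady stratum `SymmetricSteadyLiouville G`: a bounded classical
steady NS flow on `ℝ³` is a constant-in-time honest Oseen-mild window solution on `S = ℝ` (`CentreJet.steady_oseen_identity`), continuous,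
divergence free and uniformly bounded.  (The octahedral proof of `symmetricSteadyLiouville_octahedral_of_unthreadedRigidity`, p722700, is
`G`-agnostic; here it is factored through the window statement.) -/
theorem symmetricSteadyLiouville_of_symmetricWindowRigidity {G : Set (E3 → E3)} (hW : SymmetricWindowRigidity G) :
    SymmetricSteadyLiouville G := by
  intro V p hNS hB hun heq x
  obtain ⟨B, hBV⟩ := hB
  have hVc : Continuous V := (contDiffOn_univ.1 hNS.1).continuous
  have hcont : ContinuousOn (Function.uncurry (fun _ : ℝ => V)) ((univ : Set ℝ) ×ˢ (univ : Set E3)) :=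
    (hVc.comp continuous_snd).continuousOn
  have hdiv : ∀ t ∈ (univ : Set ℝ), VectorCalculus.IsDivFree ((fun _ : ℝ => V) t) :=
    fun _ _ y => hNS.2.2.1 y (mem_univ y)
  have hmild : ∀ s ∈ (univ : Set ℝ), ∀ t ∈ (univ : Set ℝ), s < t → ∀ y, (fun _ : ℝ => V) t y =
      Literature.Analysis.UnboundedOperators.heatExtension ((fun _ : ℝ => V) s) (t - s) y -
        oseenDuhamel 1 s (fun _ : ℝ => V) (fun _ : ℝ => V) t y :=
    fun s _ t _ hst y => CentreJet.steady_oseen_identity (centreJet_isSteadyNSOn_of_bounded hNS ⟨B, hBV⟩) hBV hst y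
  have hbdd : ∀ τ ∈ (univ : Set ℝ), ∃ B' : ℝ, ∀ t ∈ (univ : Set ℝ), t ≤ τ → ∀ y, ‖(fun _ : ℝ => V) t y‖ ≤ B' :=
    fun _ _ => ⟨B, fun _ _ _ y => hBV y⟩
  have hun' : ∀ t ∈ (univ : Set ℝ), ∀ y, inner ℝ (curl ((fun _ : ℝ => V) t) y) y = 0 :=
    fun _ _ y => by rw [real_inner_comm]; exact hun y
  have hequi : ∀ t ∈ (univ : Set ℝ), IsEquivariant G ((fun _ : ℝ => V) t) := fun _ _ => heq
  exact hW univ isOpen_univ isPreconnected_univ (fun _ : ℝ => V) hcont hdiv hmild hbdd hun' hequi 0 (mem_univ _) x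

/-- ★ **The steady stratum of W1 for every class of linear isometries preserving no axis, from ⟨27585⟩ alone.**  If `UnthreadedRigidity`
holds, every bounded classical steady NS flow on `ℝ³`, unthreaded about `0` and `G`-equivariant (`G` a set of linear isometries preserving
no axis), vanishes identically — independently of the sieve's conjecture `OctahedralCentreRigidity`. -/
theorem symmetricSteadyLiouville_of_unthreadedRigidity_of_isometries {G : Set (E3 → E3)}
    (hGiso : ∀ g ∈ G, ∃ L : E3 ≃ₗᵢ[ℝ] E3, ∀ x, L x = g x) (hGaxis : PreservesNoAxis G)
    (h27585 : UnthreadedRigidityDoor.UnthreadedRigidity) : SymmetricSteadyLiouville G :=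
  symmetricSteadyLiouville_of_symmetricWindowRigidity (symmetricWindowRigidity_of_unthreadedRigidity_of_isometries hGiso hGaxis h27585)

end Summit.NavierStokesRegularity.NavierStokesRegularity.Theorems.PoloidalLiouville.Platonic

end
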